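import Mathlib

/-!
# PercRepro — Claim Q, Lemma P′ and Lemma P: independent-set counts in a coloop-free matroid (typer-2, gen 6)

mine-2's CLAIM Q (bus 12:15:12Z, `proofs/MINE2-RLS.md` §13 — a stand-alone lemma of the level-wise form of
C-025 for `q = 1`): a matroid without coloops and of rank `r` has at least `C(r + 1, i)` independent sets of
size `i` for every `i ≤ r` (tight at `U_{r, r+1}`). Proof (shorter than §13's `Σ_y` bound): fix a base `B`
(`|B| = r`). The `i`-subsets of `B` are independent (`C(r, i)` of them). For every `(i − 1)`-subset `I` of `B`
pick `b ∈ B ∖ I` (possible since `i − 1 < r`); `b` is not a coloop, so some base misses it and the exchange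
axiom (`IsBase.exchange_mem`) gives `y_b ∉ B` with `insert y_b (B ∖ {b})` a base, hence `insert y_b I` is an
independent `i`-set NOT contained in `B`; `I ↦ insert y_b I` is injective (`I = (insert y_b I) ∩ B`). So there
are at least `C(r, i) + C(r, i − 1) = C(r + 1, i)` independent `i`-sets (Pascal).

* `exists_exchange_of_not_isColoop` — the exchange partner of a non-coloop element of a base;
* `ncard_subsets_eq_choose` — the `i`-subsets of a finite set (`Set.ncard_powerset_ncard`);
* **`indepCount_ge_choose_of_isBase`** — the count with an explicit base `B` (`i ≤ B.ncard`);
* **`claimQ`** — the rank form: `M.eRank = r`, `i ≤ r` ⇒ `C(r + 1, i) ≤ #{I : M.Indep I ∧ I.ncard = i}`;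
* **`indepCount_mem_ge_choose_of_isBase`** / **`lemmaP'`** — LEMMA P′: every non-loop element of a coloop-free
  matroid of rank `p` lies in at least `C(p, i)` independent `(i + 1)`-sets (`i + 1 ≤ p`) — Claim Q on the
  contraction `M ／ {x}` (`contract_isColoop_iff`, `Indep.contract_isBase_iff`, `Indep.contract_indep_iff`);
* **`lemmaP_indep`** / **`lemmaP`** — LEMMA P: at least `C(p, i)` independent `i`-sets `T ∌ x` with `x ∉ cl(T)`
  (the `J \ {x}` of Lemma P′; `Indep.insert_indep_iff_of_notMem`), hence that many sets `T ⊆ E ∖ {x}` of rank `i`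
  with `x ∉ cl(T)`;
* **`eq_disjointSum_delete_coloops_freeOn`** / **`not_isColoop_delete_coloops`** — the coloop decomposition
  `M = (M ＼ coloops) ⊕ freeOn coloops` with a coloop-free first summand (the shape of mine-2's `N = N₀ ⊕ F_{c₀}`
  for Theorem B′; `Matroid.disjointSum`, `Matroid.freeOn`).
-/

namespace PercRepro

open Set
open scoped Matroid

namespace Matroid

variable {α : Type*} {M : _root_.Matroid α}

/-- A non-coloop element `b` of a base `B` has an exchange partner `y ∉ B` with `insert y (B \ {b})` a base. -/
theorem exists_exchange_of_not_isColoop {B : Set α} (hB : M.IsBase B) {b : α} (hb : b ∈ B)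
    (hcol : ¬ M.IsColoop b) : ∃ y, y ∉ B ∧ M.IsBase (insert y (B \ {b})) := by
  rw [_root_.Matroid.isColoop_iff_forall_mem_isBase] at hcol
  simp only [not_forall] at hcol
  obtain ⟨B', hB', hbB'⟩ := hcol
  obtain ⟨y, ⟨_, hyB⟩, hy⟩ := hB.exchange_mem hB' hb hbB'
  exact ⟨y, hyB, hy⟩

/-- The number of `n`-element subsets of a finite set `s` is `C(|s|, n)`. -/
theorem ncard_subsets_eq_choose {s : Set α} (hs : s.Finite) (n : ℕ) :
    {t : Set α | t ⊆ s ∧ t.ncard = n}.ncard = s.ncard.choose n :=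
  Set.ncard_powerset_ncard hs n

/-- **Claim Q with an explicit base**: if no element of `M` is a coloop and `B` is a base, then for every
`i ≤ |B|` there are at least `C(|B| + 1, i)` independent `i`-sets. -/
theorem indepCount_ge_choose_of_isBase [M.Finite] (hcol : ∀ e, ¬ M.IsColoop e) {B : Set α}
    (hB : M.IsBase B) (i : ℕ) (hi : i ≤ B.ncard) :
    (B.ncard + 1).choose i ≤ {I : Set α | M.Indep I ∧ I.ncard = i}.ncard := by
  classical
  have hBfin : B.Finite := M.ground_finite.subset hB.subset_ground
  have hfinI : {I : Set α | M.Indep I ∧ I.ncard = i}.Finite :=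
    M.ground_finite.finite_subsets.subset fun I hI => hI.1.subset_ground
  rcases i with _ | j
  · -- `i = 0`: the empty set.
    rw [Nat.choose_zero_right, Nat.one_le_iff_ne_zero, Ne, Set.ncard_eq_zero hfinI]
    intro h
    exact Set.eq_empty_iff_forall_notMem.mp h ∅ ⟨M.empty_indep, Set.ncard_empty α⟩
  -- `i = j + 1`: Pascal.
  rw [Nat.choose_succ_succ]
  -- Family 1: the `(j+1)`-subsets of `B`.
  set F₁ : Set (Set α) := {I | I ⊆ B ∧ I.ncard = j + 1} with hF₁
  -- The `j`-subsets of `B`.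
  set P : Set (Set α) := {I | I ⊆ B ∧ I.ncard = j} with hP
  have hF₁card : F₁.ncard = B.ncard.choose (j + 1) := ncard_subsets_eq_choose hBfin (j + 1)
  have hPcard : P.ncard = B.ncard.choose j := ncard_subsets_eq_choose hBfin j
  -- For `I ∈ P` pick `b ∈ B \ I` and its exchange partner `y`.
  have hpick : ∀ I ∈ P, ∃ y, y ∉ B ∧ M.Indep (insert y I) := by
    intro I hI
    obtain ⟨hIB, hIcard⟩ := hI
    have hne : I ≠ B := by
      intro h
      rw [h] at hIcard
      omega
    obtain ⟨b, hbB, hbI⟩ := Set.exists_of_ssubset (Set.ssubset_iff_subset_ne.mpr ⟨hIB, hne⟩)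
    obtain ⟨y, hyB, hy⟩ := exists_exchange_of_not_isColoop hB hbB (hcol b)
    refine ⟨y, hyB, hy.indep.subset ?_⟩
    intro z hz
    rcases hz with rfl | hzI
    · exact Set.mem_insert _ _
    · exact Set.mem_insert_of_mem _ ⟨hIB hzI, fun h => hbI (h ▸ hzI)⟩
  have hBne : B.Nonempty := Set.nonempty_of_ncard_ne_zero (by omega)
  haveI : Nonempty α := ⟨hBne.some⟩
  choose! y hy using hpick
  set g : Set α → Set α := fun I => insert (y I) I with hg
  -- Family 2: the images `g '' P`, disjoint from `F₁`, injective.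
  have hgP : ∀ I ∈ P, g I ∈ {I : Set α | M.Indep I ∧ I.ncard = j + 1} ∧ g I ∉ F₁ := by
    intro I hI
    obtain ⟨hyB, hind⟩ := hy I hI
    have hyI : y I ∉ I := fun h => hyB (hI.1 h)
    have hIfin : I.Finite := hBfin.subset hI.1
    refine ⟨⟨hind, ?_⟩, ?_⟩
    · show (insert (y I) I).ncard = j + 1
      rw [Set.ncard_insert_of_notMem hyI hIfin, hI.2]
    · intro hmem
      exact hyB (hmem.1 (Set.mem_insert _ _))
  have hginj : Set.InjOn g P := by
    intro I hI I' hI' hII'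
    have hyB := (hy I hI).1
    have hyB' := (hy I' hI').1
    have e1 : g I ∩ B = I := by
      ext z
      simp only [hg, Set.mem_inter_iff, Set.mem_insert_iff]
      constructor
      · rintro ⟨rfl | hz, hzB⟩
        · exact absurd hzB hyB
        · exact hz
      · intro hz
        exact ⟨Or.inr hz, hI.1 hz⟩
    have e2 : g I' ∩ B = I' := by
      ext z
      simp only [hg, Set.mem_inter_iff, Set.mem_insert_iff]
      constructor
      · rintro ⟨rfl | hz, hzB⟩
        · exact absurd hzB hyB'
        · exact hz
      · intro hz
        exact ⟨Or.inr hz, hI'.1 hz⟩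
    rw [← e1, ← e2, hII']
  have hF₂card : (g '' P).ncard = B.ncard.choose j := by
    rw [hginj.ncard_image, hPcard]
  have hdisj : Disjoint F₁ (g '' P) := by
    rw [Set.disjoint_left]
    intro J hJ hJ'
    obtain ⟨I, hI, rfl⟩ := hJ'
    exact (hgP I hI).2 hJ
  have hsub : F₁ ∪ g '' P ⊆ {I : Set α | M.Indep I ∧ I.ncard = j + 1} := by
    intro J hJ
    rcases hJ with hJ | ⟨I, hI, rfl⟩
    · exact ⟨hB.indep.subset hJ.1, hJ.2⟩
    · exact (hgP I hI).1
  have hF₁fin : F₁.Finite := hfinI.subset fun J hJ => ⟨hB.indep.subset hJ.1, hJ.2⟩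
  have hF₂fin : (g '' P).Finite := hfinI.subset fun J hJ => by
    obtain ⟨I, hI, rfl⟩ := hJ
    exact (hgP I hI).1
  rw [add_comm]
  calc B.ncard.choose (j + 1) + B.ncard.choose j = F₁.ncard + (g '' P).ncard := by
        rw [hF₁card, hF₂card]
    _ = (F₁ ∪ g '' P).ncard := (Set.ncard_union_eq hdisj hF₁fin hF₂fin).symm
    _ ≤ _ := Set.ncard_le_ncard hsub hfinI

/-- **Claim Q** (mine-2, `MINE2-RLS.md` §13): a matroid without coloops and of rank `r` has at least
`C(r + 1, i)` independent `i`-sets for every `i ≤ r`. -/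
theorem claimQ [M.Finite] (hcol : ∀ e, ¬ M.IsColoop e) {r : ℕ} (hr : M.eRank = r) (i : ℕ)
    (hi : i ≤ r) : (r + 1).choose i ≤ {I : Set α | M.Indep I ∧ I.ncard = i}.ncard := by
  obtain ⟨B, hB⟩ := M.exists_isBase
  have hBfin : B.Finite := M.ground_finite.subset hB.subset_ground
  have hBcard : B.ncard = r := by
    have h := hB.encard_eq_eRank
    rw [hr, ← hBfin.cast_ncard_eq] at h
    exact_mod_cast h
  rw [← hBcard] at hi ⊢
  exact indepCount_ge_choose_of_isBase hcol hB i hi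

/-! ### Lemma P′: every element of a coloop-free matroid lies in many independent sets -/

/-- **Lemma P′ with an explicit base** (mine-2 §13): if no element is a coloop, `B` is a base and `x ∈ B`,
then for every `i + 1 ≤ |B|` the element `x` lies in at least `C(|B|, i)` independent `(i + 1)`-sets — Claim Q
for the contraction `M ／ {x}` (base `B \ {x}`, no coloops), the independent `i`-sets of which are the `J`
with `x ∉ J` and `insert x J` independent in `M`. -/
theorem indepCount_mem_ge_choose_of_isBase [M.Finite] (hcol : ∀ e, ¬ M.IsColoop e) {B : Set α}
    (hB : M.IsBase B) {x : α} (hxB : x ∈ B) (i : ℕ) (hi : i + 1 ≤ B.ncard) :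
    B.ncard.choose i ≤ {J : Set α | M.Indep J ∧ x ∈ J ∧ J.ncard = i + 1}.ncard := by
  classical
  have hBfin : B.Finite := M.ground_finite.subset hB.subset_ground
  have hx : M.Indep {x} := hB.indep.subset (Set.singleton_subset_iff.mpr hxB)
  -- the contraction `M ／ {x}`
  have hcol' : ∀ e, ¬ (M ／ {x}).IsColoop e := fun e h =>
    hcol e ((_root_.Matroid.contract_isColoop_iff).mp h).1
  have hB' : (M ／ {x}).IsBase (B \ {x}) := by
    rw [hx.contract_isBase_iff]
    refine ⟨?_, Set.disjoint_sdiff_left⟩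
    rwa [Set.sdiff_union_of_subset (Set.singleton_subset_iff.mpr hxB)]
  have hcard' : (B \ {x}).ncard = B.ncard - 1 := Set.ncard_sdiff_singleton_of_mem hxB
  have hi' : i ≤ (B \ {x}).ncard := by omega
  have hQ := indepCount_ge_choose_of_isBase (M := M ／ {x}) hcol' hB' i hi'
  rw [hcard', Nat.sub_add_cancel (by omega : 1 ≤ B.ncard)] at hQ
  refine hQ.trans ?_
  -- `J ↦ insert x J` injects the independent `i`-sets of `M ／ {x}` into the independent
  -- `(i+1)`-sets of `M` through `x`.
  have hfin : {J : Set α | M.Indep J ∧ x ∈ J ∧ J.ncard = i + 1}.Finite :=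
    M.ground_finite.finite_subsets.subset fun J hJ => hJ.1.subset_ground
  refine Set.ncard_le_ncard_of_injOn (fun J => insert x J) ?_ ?_ hfin
  · intro J hJ
    obtain ⟨hJind, hJcard⟩ := hJ
    rw [hx.contract_indep_iff] at hJind
    obtain ⟨hdisj, hind⟩ := hJind
    have hxJ : x ∉ J := fun h => Set.disjoint_left.mp hdisj h rfl
    have hJfin : J.Finite := M.ground_finite.subset (hind.subset_ground.trans' Set.subset_union_left)
    refine ⟨?_, Set.mem_insert _ _, ?_⟩
    · rw [Set.insert_eq, Set.union_comm]
      exact hind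
    · rw [Set.ncard_insert_of_notMem hxJ hJfin, hJcard]
  · intro J hJ J' hJ' hJJ'
    have hxJ : x ∉ J := by
      obtain ⟨hJind, _⟩ := hJ
      rw [hx.contract_indep_iff] at hJind
      exact fun h => Set.disjoint_left.mp hJind.1 h rfl
    have hxJ' : x ∉ J' := by
      obtain ⟨hJind, _⟩ := hJ'
      rw [hx.contract_indep_iff] at hJind
      exact fun h => Set.disjoint_left.mp hJind.1 h rfl
    have e1 : insert x J \ {x} = J := Set.insert_sdiff_self_of_notMem hxJ
    have e2 : insert x J' \ {x} = J' := Set.insert_sdiff_self_of_notMem hxJ'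
    rw [← e1, ← e2]
    exact congrArg (· \ {x}) hJJ'

/-- **Lemma P′** (mine-2, `MINE2-RLS.md` §13): in a matroid without coloops and of rank `p`, every non-loop
element `x` lies in at least `C(p, i)` independent `(i + 1)`-sets for every `i + 1 ≤ p`. -/
theorem lemmaP' [M.Finite] (hcol : ∀ e, ¬ M.IsColoop e) {p : ℕ} (hr : M.eRank = p) {x : α}
    (hx : M.Indep {x}) (i : ℕ) (hi : i + 1 ≤ p) :
    p.choose i ≤ {J : Set α | M.Indep J ∧ x ∈ J ∧ J.ncard = i + 1}.ncard := by
  obtain ⟨B, hB, hxB⟩ := hx.exists_isBase_superset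
  have hBfin : B.Finite := M.ground_finite.subset hB.subset_ground
  have hBcard : B.ncard = p := by
    have h := hB.encard_eq_eRank
    rw [hr, ← hBfin.cast_ncard_eq] at h
    exact_mod_cast h
  rw [← hBcard] at hi ⊢
  exact indepCount_mem_ge_choose_of_isBase hcol hB (Set.singleton_subset_iff.mp hxB) i hi

/-! ### Lemma P: free sets — `x ∉ cl(T)` for many independent `i`-sets `T` -/

/-- **Lemma P, independent form** (mine-2 §13): in a matroid without coloops and of rank `p`, for every non-loop
`x` and `i + 1 ≤ p` there are at least `C(p, i)` independent `i`-sets `T ∌ x` with `x ∉ cl(T)` — the sets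
`J \ {x}` for the `J` of Lemma P′. -/
theorem lemmaP_indep [M.Finite] (hcol : ∀ e, ¬ M.IsColoop e) {p : ℕ} (hr : M.eRank = p) {x : α}
    (hx : M.Indep {x}) (i : ℕ) (hi : i + 1 ≤ p) :
    p.choose i ≤ {T : Set α | M.Indep T ∧ x ∉ T ∧ x ∉ M.closure T ∧ T.ncard = i}.ncard := by
  classical
  refine (lemmaP' hcol hr hx i hi).trans ?_
  have hfin : {T : Set α | M.Indep T ∧ x ∉ T ∧ x ∉ M.closure T ∧ T.ncard = i}.Finite :=
    M.ground_finite.finite_subsets.subset fun T hT => hT.1.subset_ground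
  refine Set.ncard_le_ncard_of_injOn (fun J => J \ {x}) ?_ ?_ hfin
  · intro J hJ
    obtain ⟨hJind, hxJ, hJcard⟩ := hJ
    have hT : M.Indep (J \ {x}) := hJind.subset Set.sdiff_subset
    have hxT : x ∉ J \ {x} := fun h => h.2 rfl
    have hins : insert x (J \ {x}) = J := Set.insert_sdiff_singleton.trans (Set.insert_eq_of_mem hxJ)
    refine ⟨hT, hxT, ?_, ?_⟩
    · have hJ' : M.Indep (insert x (J \ {x})) := by rw [hins]; exact hJind
      exact ((hT.insert_indep_iff_of_notMem hxT).mp hJ').2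
    · rw [Set.ncard_sdiff_singleton_of_mem hxJ, hJcard]
      rfl
  · intro J hJ J' hJ' hJJ'
    have e1 : insert x (J \ {x}) = J := Set.insert_sdiff_singleton.trans (Set.insert_eq_of_mem hJ.2.1)
    have e2 : insert x (J' \ {x}) = J' :=
      Set.insert_sdiff_singleton.trans (Set.insert_eq_of_mem hJ'.2.1)
    rw [← e1, ← e2]
    exact congrArg (insert x) hJJ'

/-- **Lemma P** (mine-2 §13, rank form): in a matroid without coloops and of rank `p`, for every non-loop `x`
and `i + 1 ≤ p` there are at least `C(p, i)` sets `T ⊆ E ∖ {x}` of rank `i` with `x ∉ cl(T)`. -/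
theorem lemmaP [M.Finite] (hcol : ∀ e, ¬ M.IsColoop e) {p : ℕ} (hr : M.eRank = p) {x : α}
    (hx : M.Indep {x}) (i : ℕ) (hi : i + 1 ≤ p) :
    p.choose i ≤ {T : Set α | T ⊆ M.E \ {x} ∧ M.eRk T = (i : ℕ∞) ∧ x ∉ M.closure T}.ncard := by
  classical
  refine (lemmaP_indep hcol hr hx i hi).trans (Set.ncard_le_ncard ?_ ?_)
  · intro T hT
    obtain ⟨hTind, hxT, hxcl, hTcard⟩ := hT
    have hTfin : T.Finite := M.ground_finite.subset hTind.subset_ground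
    refine ⟨?_, ?_, hxcl⟩
    · intro e he
      exact ⟨hTind.subset_ground he, fun h => hxT (h ▸ he)⟩
    · rw [hTind.eRk_eq_encard, ← hTfin.cast_ncard_eq, hTcard]
  · exact M.ground_finite.finite_subsets.subset fun T hT => hT.1.trans Set.sdiff_subset

/-! ### The coloop decomposition `N = N₀ ⊕ F_{c₀}` (for Theorem B′) -/

/-- The coloops of `M` are disjoint from the ground set of `M ＼ M.coloops`. -/
theorem disjoint_delete_coloops_ground (M : _root_.Matroid α) :
    Disjoint (M ＼ M.coloops).E (_root_.Matroid.freeOn M.coloops).E := by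
  rw [_root_.Matroid.delete_ground, _root_.Matroid.freeOn_ground]
  exact Set.disjoint_sdiff_left

/-- **Every matroid is the direct sum of its coloop-free part and the free matroid on its coloops**:
`M = (M ＼ coloops) ⊕ freeOn coloops` (independent sets: `I` independent iff `I ∖ coloops` independent,
`sdiff_coloops_indep_iff`). -/
theorem eq_disjointSum_delete_coloops_freeOn (M : _root_.Matroid α) :
    M = (M ＼ M.coloops).disjointSum (_root_.Matroid.freeOn M.coloops)
      (disjoint_delete_coloops_ground M) := by
  have hC : M.coloops ⊆ M.E := M.coloops_subset_ground
  refine _root_.Matroid.ext_indep ?_ fun I hI => ?_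
  · rw [_root_.Matroid.disjointSum_ground_eq, _root_.Matroid.delete_ground,
      _root_.Matroid.freeOn_ground, Set.sdiff_union_of_subset hC]
  · rw [_root_.Matroid.disjointSum_indep_iff, _root_.Matroid.delete_indep_iff,
      _root_.Matroid.freeOn_indep_iff, _root_.Matroid.delete_ground, _root_.Matroid.freeOn_ground,
      Set.sdiff_union_of_subset hC]
    have e1 : I ∩ (M.E \ M.coloops) = I \ M.coloops := by
      ext e
      simp only [Set.mem_inter_iff, Set.mem_sdiff]
      exact ⟨fun h => ⟨h.1, h.2.2⟩, fun h => ⟨h.1, hI h.1, h.2⟩⟩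
    rw [e1]
    constructor
    · intro h
      exact ⟨⟨_root_.Matroid.sdiff_coloops_indep_iff.mpr h, Set.disjoint_sdiff_left⟩,
        Set.inter_subset_right, hI⟩
    · rintro ⟨⟨h, -⟩, -, -⟩
      exact _root_.Matroid.sdiff_coloops_indep_iff.mp h

/-- **Deleting the coloops leaves no coloop**: `M ＼ M.coloops` is coloop-free. -/
theorem not_isColoop_delete_coloops (M : _root_.Matroid α) (e : α) :
    ¬ (M ＼ M.coloops).IsColoop e := by
  rw [_root_.Matroid.delete_isColoop_iff]
  rintro ⟨hecl, heE, heC⟩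
  -- `e` is not a coloop of `M`, so `e ∈ cl(E ∖ {e}) = cl((E ∖ C) ∖ {e}) ∪ C`.
  have hne : ¬ M.IsColoop e := heC
  rw [_root_.Matroid.isColoop_iff_notMem_closure_compl heE, not_not] at hne
  have hsplit : M.E \ {e} = (M.E \ M.coloops) \ {e} ∪ M.coloops := by
    ext x
    simp only [Set.mem_sdiff, Set.mem_singleton_iff, Set.mem_union]
    constructor
    · rintro ⟨hxE, hxe⟩
      by_cases hx : x ∈ M.coloops
      · exact Or.inr hx
      · exact Or.inl ⟨⟨hxE, hx⟩, hxe⟩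
    · rintro (⟨⟨hxE, _⟩, hxe⟩ | hx)
      · exact ⟨hxE, hxe⟩
      · exact ⟨M.coloops_subset_ground hx, fun h => heC (h ▸ hx)⟩
  rw [hsplit, _root_.Matroid.closure_union_eq_of_subset_coloops _ Subset.rfl] at hne
  rcases hne with h | h
  · exact hecl h
  · exact heC h

end Matroid

end PercRepro
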